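import Literature.MathematicalPhysics.KineticTheory.HardSphereEulerProofs

/-!
# The squeeze `SqueezeToBlockGibbs` (route JaynesSqueeze), IV: uniformity of the local density approximation

Helper file (`--supports stmt-AtomisticToContinuum-13463`) for the support item `SqueezeToBlockGibbs` of route
`JaynesSqueeze`. Step (ii) of the item's plan uses the static input `HardSphereLDA` (B) — the local density
approximation `(N+1)⁻¹ log Z_N(a_ρ) → ∫ ρ · ρσ³ f_ex′(ρσ³)` for ONE fixed activity profile — UNIFORMLY over the
compact family of block-constant profiles produced by `MeanBlocksInRange` (the block parameters depend on `N` and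
on the time `s`). Two elementary facts make the pointwise statement uniform:

* `posPartition_le_exp_mul_posPartition` — the configurational partition function is log-Lipschitz in the
  activity: `|log b − log b'| ≤ D` pointwise gives `Z(b) ≤ e^{nD} Z(b')` (so `(N+1)⁻¹ log Z_N` is
  `1`-Lipschitz for the sup-distance of the log-activities);
* `eventually_forall_abs_sub_le_of_tendsto` — an abstract Arzelà–Ascoli-type lemma: on a compact set, a sequence
  of functions that is equi-Lipschitz through a continuous map and converges pointwise to a continuous limit
  converges uniformly (sequential compactness + a `3ε` argument).

References: Ruelle 1969 §3.4 (thermodynamic limit of the free energy; monotonicity in the activity).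
-/

noncomputable section

open MeasureTheory Filter Set Topology
open scoped ENNReal

namespace Summit.AtomisticToContinuum.HydrodynamicLimit.Theorems.JaynesSqueezeSqueeze

open Literature.MathematicalPhysics.KineticTheory Literature.Analysis.FluidPDE
open Literature.Analysis.FunctionSpaces

/-! ## Log-Lipschitz dependence of the configurational partition function on the activity -/

/-- The position weight is monotone up to the factor `e^{nD}` under a `D`-perturbation of the log-activity:
`|log b − log b'| ≤ D` pointwise (`b, b' > 0`) gives `posWeight b ≤ e^{nD} posWeight b'`. [folklore] -/
theorem posWeight_le_exp_mul_posWeight {b b' : T3 → ℝ} (hb0 : ∀ x, 0 < b x) (hb'0 : ∀ x, 0 < b' x) {D : ℝ}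
    (hD : ∀ x, |Real.log (b x) - Real.log (b' x)| ≤ D) (ε : ℝ) {n : ℕ} (x : Fin n → T3) :
    posWeight b ε n x ≤ Real.exp (n * D) * posWeight b' ε n x := by
  have hpt : ∀ y, b y ≤ Real.exp D * b' y := by
    intro y
    have h1 : Real.log (b y) ≤ D + Real.log (b' y) := by linarith [(abs_le.1 (hD y)).2]
    calc b y = Real.exp (Real.log (b y)) := (Real.exp_log (hb0 y)).symm
      _ ≤ Real.exp (D + Real.log (b' y)) := Real.exp_le_exp.2 h1
      _ = Real.exp D * b' y := by rw [Real.exp_add, Real.exp_log (hb'0 y)]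
  unfold posWeight
  by_cases hx : x ∈ posDomain ε n
  · rw [indicator_of_mem hx, indicator_of_mem hx]
    calc ∏ i, b (x i) ≤ ∏ i, (Real.exp D * b' (x i)) :=
          Finset.prod_le_prod (fun i _ => (hb0 _).le) fun i _ => hpt _
      _ = Real.exp (n * D) * ∏ i, b' (x i) := by
          rw [Finset.prod_mul_distrib, Finset.prod_const, Finset.card_univ, Fintype.card_fin, ← Real.exp_nat_mul]
  · rw [indicator_of_notMem hx, indicator_of_notMem hx, mul_zero]

/-- **The configurational partition function is log-Lipschitz in the activity**: for measurable activities
`0 < b, b' ≤ B` with `|log b − log b'| ≤ D` pointwise, `Z_pos(b) ≤ e^{nD} Z_pos(b')`. [folklore] -/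
theorem posPartition_le_exp_mul_posPartition {b b' : T3 → ℝ} (hb' : Measurable b')
    (hb0 : ∀ x, 0 < b x) (hb'0 : ∀ x, 0 < b' x) {B : ℝ} (hb'B : ∀ x, b' x ≤ B) {D : ℝ}
    (hD : ∀ x, |Real.log (b x) - Real.log (b' x)| ≤ D) (ε : ℝ) (n : ℕ) :
    posPartition b ε n ≤ Real.exp (n * D) * posPartition b' ε n := by
  unfold posPartition
  rw [← integral_const_mul]
  have hm' : Measurable (posWeight b' ε n) :=
    (Finset.measurable_prod _ fun i _ => hb'.comp (measurable_pi_apply i)).indicator (measurableSet_posDomain ε n)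
  have hint : Integrable (fun x => Real.exp (n * D) * posWeight b' ε n x) := by
    refine ((integrable_const (B ^ n)).mono' hm'.aestronglyMeasurable (Eventually.of_forall fun x => ?_)).const_mul _
    rw [Real.norm_eq_abs, abs_of_nonneg (posWeight_nonneg (fun y => (hb'0 y).le) ε x)]
    exact posWeight_le_pow (fun y => (hb'0 y).le) hb'B ε x
  exact integral_mono_of_nonneg (Eventually.of_forall fun x => posWeight_nonneg (fun y => (hb0 y).le) ε x) hint
    (Eventually.of_forall fun x => posWeight_le_exp_mul_posWeight hb0 hb'0 hD ε x)

/-- Logarithmic form: for measurable activities `0 < b, b' ≤ B` with POSITIVE configurational partition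
functions and `|log b − log b'| ≤ D` pointwise, `|log Z_pos(b) − log Z_pos(b')| ≤ nD`. [folklore] -/
theorem abs_log_posPartition_sub_le {b b' : T3 → ℝ} (hb : Measurable b) (hb' : Measurable b')
    (hb0 : ∀ x, 0 < b x) (hb'0 : ∀ x, 0 < b' x) {B : ℝ} (hbB : ∀ x, b x ≤ B) (hb'B : ∀ x, b' x ≤ B) {D : ℝ}
    (hD : ∀ x, |Real.log (b x) - Real.log (b' x)| ≤ D) (ε : ℝ) (n : ℕ)
    (hZ : 0 < posPartition b ε n) (hZ' : 0 < posPartition b' ε n) :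
    |Real.log (posPartition b ε n) - Real.log (posPartition b' ε n)| ≤ n * D := by
  have hD' : ∀ x, |Real.log (b' x) - Real.log (b x)| ≤ D := fun x => by rw [abs_sub_comm]; exact hD x
  have h1 := posPartition_le_exp_mul_posPartition hb' hb0 hb'0 hb'B hD ε n
  have h2 := posPartition_le_exp_mul_posPartition hb hb'0 hb0 hbB hD' ε n
  have h1' : Real.log (posPartition b ε n) ≤ n * D + Real.log (posPartition b' ε n) := by
    have := Real.log_le_log hZ h1
    rwa [Real.log_mul (Real.exp_pos _).ne' hZ'.ne', Real.log_exp] at this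
  have h2' : Real.log (posPartition b' ε n) ≤ n * D + Real.log (posPartition b ε n) := by
    have := Real.log_le_log hZ' h2
    rwa [Real.log_mul (Real.exp_pos _).ne' hZ.ne', Real.log_exp] at this
  rw [abs_le]
  constructor <;> linarith

/-! ## From pointwise to uniform convergence on a compact set -/

/-- **Equi-Lipschitz pointwise convergence on a compact set is uniform.** Let `s` be a compact subset of a
pseudo-metric space, `f N : X → ℝ` a sequence of functions which is equi-Lipschitz on `s` THROUGH a map `L`
continuous on `s` (`|f N x − f N y| ≤ dist (L x) (L y)`), converging pointwise on `s` to a limit `g`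
continuous on `s`. Then the convergence is uniform on `s`: for every `ε > 0`, eventually in `N`,
`|f N x − g x| ≤ ε` for all `x ∈ s`. (Sequential compactness and a three-epsilon argument.) [folklore] -/
theorem eventually_forall_abs_sub_le_of_tendsto {X Y : Type*} [PseudoMetricSpace X] [PseudoMetricSpace Y]
    {s : Set X} (hs : IsCompact s) {f : ℕ → X → ℝ} {g : X → ℝ} {L : X → Y}
    (hg : ContinuousOn g s) (hL : ContinuousOn L s)
    (hlip : ∀ N, ∀ x ∈ s, ∀ y ∈ s, |f N x - f N y| ≤ dist (L x) (L y))
    (hpt : ∀ x ∈ s, Tendsto (fun N => f N x) atTop (𝓝 (g x))) {ε : ℝ} (hε : 0 < ε) :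
    ∀ᶠ N in atTop, ∀ x ∈ s, |f N x - g x| ≤ ε := by
  by_contra hcon
  have hfreq : ∃ᶠ N in atTop, ∃ x ∈ s, ε < |f N x - g x| := by
    rw [Filter.not_eventually] at hcon
    refine hcon.mono fun N hN => ?_
    push Not at hN
    exact hN
  obtain ⟨φ, hφ, hφP⟩ := extraction_of_frequently_atTop hfreq
  choose x hxs hxε using hφP
  obtain ⟨a, has, ψ, hψ, hlim⟩ := hs.tendsto_subseq hxs
  have hx' : Tendsto (x ∘ ψ) atTop (𝓝[s] a) :=
    tendsto_nhdsWithin_iff.2 ⟨hlim, Eventually.of_forall fun n => hxs _⟩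
  -- the three small terms
  have h1 : Tendsto (fun n => |f (φ (ψ n)) a - g a|) atTop (𝓝 0) := by
    have h := (hpt a has).comp ((hφ.comp hψ).tendsto_atTop)
    have := (tendsto_iff_norm_sub_tendsto_zero.1 h)
    simpa [Function.comp_def, Real.norm_eq_abs] using this
  have h2 : Tendsto (fun n => dist (L (x (ψ n))) (L a)) atTop (𝓝 0) := by
    have h := (hL a has).tendsto.comp hx'
    exact tendsto_iff_dist_tendsto_zero.1 h
  have h3 : Tendsto (fun n => |g (x (ψ n)) - g a|) atTop (𝓝 0) := by
    have h := (hg a has).tendsto.comp hx'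
    have := (tendsto_iff_norm_sub_tendsto_zero.1 h)
    simpa [Function.comp_def, Real.norm_eq_abs] using this
  have hsum : Tendsto (fun n => dist (L (x (ψ n))) (L a) + |f (φ (ψ n)) a - g a| + |g (x (ψ n)) - g a|)
      atTop (𝓝 0) := by
    simpa using (h2.add h1).add h3
  -- but each term of the extracted sequence is `> ε`
  have hbig : ∀ n, ε < dist (L (x (ψ n))) (L a) + |f (φ (ψ n)) a - g a| + |g (x (ψ n)) - g a| := by
    intro n
    have hε' := hxε (ψ n)
    have hA := hlip (φ (ψ n)) (x (ψ n)) (hxs _) a has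
    have htri : |f (φ (ψ n)) (x (ψ n)) - g (x (ψ n))| ≤
        |f (φ (ψ n)) (x (ψ n)) - f (φ (ψ n)) a| + |f (φ (ψ n)) a - g a| + |g (x (ψ n)) - g a| := by
      have e : f (φ (ψ n)) (x (ψ n)) - g (x (ψ n)) =
          (f (φ (ψ n)) (x (ψ n)) - f (φ (ψ n)) a) + (f (φ (ψ n)) a - g a) - (g (x (ψ n)) - g a) := by ring
      rw [e]
      refine (abs_sub _ _).trans ?_
      gcongr
      exact abs_add_le _ _
    linarith
  have hev := (tendsto_order.1 hsum).2 ε hε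
  obtain ⟨n, hn⟩ := hev.exists
  exact absurd (hbig n) (not_lt.2 hn.le)

end Summit.AtomisticToContinuum.HydrodynamicLimit.Theorems.JaynesSqueezeSqueeze

end
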